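import Summits.AnomalousDissipation.AnomalousDissipation.Theses.TwoAndHalfD
import Summits.AnomalousDissipation.AnomalousDissipation.Theorems.TwoAndHalfDScalarLift2halfDREngine
import Summits.AnomalousDissipation.AnomalousDissipation.Theorems.TwoAndHalfDScalarLift2halfDRForcedLimit
import Summits.AnomalousDissipation.AnomalousDissipation.Theorems.TwoAndHalfDScalarLift2halfDRTrace
import Summits.AnomalousDissipation.AnomalousDissipation.Theorems.TwoAndHalfDScalarLift2halfDRGlue
import Literature.Analysis.FluidPDE.LerayHopfRestartTorus

/-!
# Route TwoAndHalfD — the repaired scalar lift `ScalarLift2halfDR`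

Item `stmt-AnomalousDissipation-14983` (support, rank 9) of route
`route-AnomalousDissipation-TwoAndHalfD`: for `ν > 0`, smooth divergence-free `g`, smooth `h`,
`θ₀ ∈ L²(T²)` and a global Leray–Hopf solution `v` of 2-D Navier–Stokes forced by `g` (from a
possibly junk datum `v₀`), there are a global weak sourced scalar `θ` from `θ₀` over `v`
(`∂ₜθ + v·∇θ = νΔθ + h` weakly) and a time `s ≥ 0` such that the `2½`-dimensional field
`u(t) = (v(t+s), θ(t+s)) ∘ π` is a global Leray–Hopf solution on `T³` forced by `(g, h) ∘ π`
from the honest datum `(v(s), θ(s)) ∘ π`.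

## Proof (restart at a good time, `2½`-D Galerkin sectioning, gluing)

1. A weak sourced scalar `θ₁` on `[0, 2)` from `θ₀` over `v` exists (vanishing diffusivity-free
   Galerkin/regularisation limit for `L²ₜL²ₓ` drifts; `exists_isWeakScalarTransportForcedOn_of_sq`).
2. Almost every `σ ∈ (0, 2)` is simultaneously: a restart time of `v` (`v(· + σ)` is a global
   Leray–Hopf solution from `v σ`, `IsGlobalLerayHopf.ae_isGlobalLerayHopf_translate`), a time of
   weak incompressibility of `v σ`, and an `L²`-trace time of `θ₁` (`θ₁ σ ∈ L²` and the
   time-sliced weak identity holds at `σ` for every smooth space–time test,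
   `ae_forall_traceIdentity'`); pick such a `σ ∈ (0, 1)`.
3. THE ENGINE (`exists_scalar_lift_isGlobalLerayHopf`): from the honest data `(v σ, θ₁ σ)` there
   is `Θ` with `Θ 0 = θ₁ σ`, `(v(·+σ), Θ) ∘ π` a global Leray–Hopf solution forced by `(g,h) ∘ π`,
   and `Θ` a global weak sourced scalar over `v(· + σ)` — the vertical component of the
   `2½`-dimensional limit of translation-invariant Hopf–Galerkin approximations, whose planar
   part is `v(· + σ)` by sectioning and Lions–Prodi uniqueness in 2-D.
4. GLUING (`isWeakScalarTransportForced_glue`): `θ := θ₁` on `t ≤ σ`, `Θ(· - σ)` after, is a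
   global weak sourced scalar from `θ₀` over `v`, by the trace identity at `σ`.
5. With `s := σ`, `(v(t+s), θ(t+s)) = (v(t+s), Θ t)` for `t ≥ 0`, so the lift is the engine's
   Leray–Hopf solution (slicewise equality on `[0, T]`, `lerayHopfOn_congr_slices`).

## References

* E. Bruè, C. De Lellis, *Anomalous dissipation for the forced 3D Navier–Stokes equations*,
  Comm. Math. Phys. 400 (2023), §3 (the `2½`-dimensional architecture).
* R. J. DiPerna, P.-L. Lions, Invent. Math. 98 (1989), §II (weak passive scalars).
* J.-L. Lions, G. Prodi, C. R. Acad. Sci. Paris 248 (1959) (uniqueness in 2-D).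
* R. Temam, *Navier–Stokes Equations* (1984), Ch. III (weak formulations, Galerkin method).
-/

noncomputable section

open MeasureTheory Set Filter Topology Function UnitAddTorus
open scoped ENNReal NNReal InnerProductSpace ContDiff
open Literature.Analysis.FunctionSpaces Literature.Analysis.FunctionSpaces.Torus
open Literature.Analysis.FluidPDE Literature.Analysis.FluidPDE.Torus

namespace Summit.AnomalousDissipation.AnomalousDissipation.Theorems

-- D-0017: single-problem summit ⇒ `Summit.AnomalousDissipation.AnomalousDissipation.…` by design.
set_option linter.dupNamespace false

/-- **The repaired scalar lift `ScalarLift2halfDR`** (route TwoAndHalfD): for `ν > 0`, smooth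
divergence-free `g`, smooth `h`, `θ₀ ∈ L²` and a global Leray–Hopf solution `v` of 2-D
Navier–Stokes forced by `g`, there are a global weak sourced scalar `θ` from `θ₀` over `v` and a
time `s ≥ 0` such that `(v(·+s), θ(·+s)) ∘ π` is a global Leray–Hopf solution on `T³` forced by
`(g, h) ∘ π` from `(v(s), θ(s)) ∘ π` (restart at a good time, the `2½`-D Galerkin engine, and
gluing at an `L²`-trace time). -/
theorem scalarLift2halfDR_proof :
    Summit.AnomalousDissipation.AnomalousDissipation.Theses.TwoAndHalfD.ScalarLift2halfDR := by
  unfold Summit.AnomalousDissipation.AnomalousDissipation.Theses.TwoAndHalfD.ScalarLift2halfDR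
  intro ν g h v₀ v θ₀ hν hg _hgdiv hh hθ₀ hv
  -- ### Step 1: a weak sourced scalar on the horizon `[0, 2)` from `θ₀`
  have hLH2 := hv 2 two_pos
  obtain ⟨M, hM⟩ := hLH2.energy_bound
  obtain ⟨θ₁, hθ₁⟩ := exists_isWeakScalarTransportForcedOn_of_sq hν two_pos hθ₀ hLH2.weak.1 hM
    hLH2.weak.ae_isWeaklyDivFree hh
  -- ### Step 2: a good restart time `σ ∈ (0, 1)`
  have hgood : ∀ᵐ σ ∂(volume.restrict (Ioo (0 : ℝ) 2)), (0 < σ →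
      IsGlobalLerayHopf ν (fun _ => g) (v σ) (fun t => v (t + σ))) ∧ IsWeaklyDivFree (v σ) ∧
      (MemLp (θ₁ σ) 2 volume ∧ ∀ ψ : ℝ → UnitAddTorus (Fin 2) → ℝ, ContDiff ℝ ∞ (stLift ψ) →
        ∫ x, θ₁ σ x * ψ σ x = (∫ x, θ₀ x * ψ 0 x) +
          ∫ t in Ioc 0 σ, ((∫ x, θ₁ t x * (Torus.timeDeriv ψ t x + ⟪v t x, Torus.gradient (ψ t) x⟫_ℝ +
            ν * Torus.laplacian (ψ t) x)) + ∫ x, h x * ψ t x)) := by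
    filter_upwards [ae_restrict_of_ae (hv.ae_isGlobalLerayHopf_translate hg hν.le),
      hLH2.weak.ae_isWeaklyDivFree, ae_forall_traceIdentity' hθ₁] with σ h1 h2 h3
    exact ⟨h1, h2, h3⟩
  obtain ⟨σ, hσ, hrestart, hdivσ, htr⟩ := exists_mem_Ioo_of_ae_Ioo one_pos (by norm_num : (1 : ℝ) ≤ 2) hgood
  have hv' : IsGlobalLerayHopf ν (fun _ => g) (v σ) (fun t => v (t + σ)) := hrestart hσ.1
  have hσ2 : σ < 2 := by linarith [hσ.2]
  have haL2 : MemLp (v σ) 2 volume := hLH2.memLp σ ⟨hσ.1.le, hσ2.le⟩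
  -- ### Step 3: the engine from the honest data `(v σ, θ₁ σ)`
  obtain ⟨Θ, hΘ0, hlift, hΘweak⟩ :=
    exists_scalar_lift_isGlobalLerayHopf hν hg hh haL2 hdivσ htr.1 hv' (by simp)
  -- ### Step 4: glue `θ₁` (before `σ`) and `Θ(· - σ)` (after `σ`)
  set θ : ℝ → UnitAddTorus (Fin 2) → ℝ := fun t => if t ≤ σ then θ₁ t else Θ (t - σ) with hθ_def
  have hglue : IsWeakScalarTransportForced ν v (fun _ => h) θ₀ θ :=
    isWeakScalarTransportForced_glue hσ.1 hσ2 hθ₁ htr.2 hΘweak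
  refine ⟨θ, hglue, σ, hσ.1.le, ?_⟩
  -- ### Step 5: the lift from `σ` is the engine's lift on `t ≥ 0`
  have hθσ : θ σ = θ₁ σ := by simp [hθ_def]
  have heq : ∀ t, 0 ≤ t → θ (t + σ) = Θ t := by
    intro t ht
    rcases eq_or_lt_of_le ht with rfl | ht'
    · simp [hθ_def, hΘ0]
    · have : ¬ (t + σ ≤ σ) := by linarith
      simp [hθ_def, this]
  rw [hθσ]
  intro T hT
  refine lerayHopfOn_congr_slices (hlift T hT) hT (fun t ht => ?_) ?_
  · rw [heq t ht.1]
  · have hm := (hlift T hT).weak.1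
    refine hm.congr ?_
    filter_upwards [ae_restrict_mem (measurableSet_Ioo.prod MeasurableSet.univ)] with p hp
    simp only [stLift, heq p.1 (le_of_lt hp.1.1)]

end Summit.AnomalousDissipation.AnomalousDissipation.Theorems

end
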